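import Summits.QuantumFields.YangMills.Theorems.UnitScaleTiltProp7PillarsPrint
import Summits.QuantumFields.YangMills.Theorems.UnitScaleTiltProp7PV3CDENative
import Summits.QuantumFields.YangMills.Theorems.UnitScaleTiltProp7TPrintDefs
import HarnessLib

/-!
# Route `UnitScaleTilt`, crux K1 child «MinimiserStabilityRegPr» (stmt-QuantumFields-19200), registered stub `stub_prop7From14` (skeleton birth_v7
# cc37a178…; leaf V3) — PILLAR P-V3-CDE AT THE LOG-CHART LETTERS `Prop7TPrint.tPrintFam A`: [Balaban1985Variational] PROPOSITION 5 AND THE LEAF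
# `crit112` ARE THEOREMS, PROPOSITION 6 IS ONE NATIVE STATEMENT («exactly one configuration critical in (19)–(21) near a (14)-background»), AND THE
# LEAF V3 FOLLOWS FROM P-V3-A + THAT STATEMENT + THE p. 299 RETURN TO (18) IN PRINT'S REGIME + (142)

Cell `ym3-torus`, width seat `ym-ust-19200-w2` (gen 0; D-0149; OWNER W-SEAT START LIST 2026-08-27 22:29Z «w2 = P-V3-CDE»; RULING g23-№3 (α)).  YM₃ on T³ is a
ladder rung (R3), not the Clay problem; nothing here is a claim about the crux, d = 4 or the mass gap.

WHY.  The owner's v8 re-cut of V3 (CARD-19200-V3-g8 §3) is `stub_prop7From14 ⇐ stub_PV3A ∧ stub_PV3CDE` via `Prop7PillarsPrint.prop7From14At_of_pillars_print`,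
with P-V3-CDE = `Prop5Printed ∧ Prop6Printed (famLG3 L S_print) ∧ ∀ i, ExistenceLeavesCap (bridgeFam3 L S_print i)`.  Seat w1 types the Sect. A letters of
`S_print` (`IsAxial`/`Restricted` based (1.19)/(1.29), `AvgCond`, `IsLandau`, `CritL`); the Sect. C–E letters are this seat's `Prop7TPrint.tPrintOf` (log-chart
reading: `T112 = e^{iX}`, `nMax` = the four (19) quantities, `Sol111` = «𝔰𝔲(2)-exponent ∧ (20) ∧ (21) ∧ critical in (19)–(21)»).  THIS FILE settles what
P-V3-CDE then IS at the T³ objects: two of its five pieces are theorems, and the remaining content is three native statements, each a printed sentence.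

WHAT IS PROVED (sorry-free, no definition).
§1 `eq_expHermField_of_in19`, `pos_of_in19`, `nMax19_lt_of_in19`, `in19_expHermField_of_nMax19_lt` ((19) ↔ size bookkeeping);
   **`prop5Printed_logChart : Prop5Printed B₁ B₃ C₁ (famLG3 L (tPrintFam A))`** for EVERY `A`, `B₁`, `B₃`, `C₁`.
§2 **`crit112_logChart`** — the leaf `crit112` at `tPrintFam A` with `O₁ ≥ 3B₀`.
§3 **`prop6Printed_logChart_iff`** — `Prop6Printed B₀ B₃ C₁ (famLG3 L (tPrintFam A))` ⟺ «for every (14)-background and `2B₀C₁B₃ε₁ ≤ ε₄ ≤ a₄`: exactly one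
   Hermitian traceless `X` of size `< ε₄` with (20), (21) and `e^{iX}` critical in (19)–(21); its size is `< 3B₀C₁B₃ε₁`» (p. 296 + Prop. 6 + (123)–(140)).
§4 **`prop7From14At_of_natives_logChart`** — `T3Thm1CarrierNative.Prop7From14At L B₃` (leaf V3 BY NAME) from: P-V3-A (`∃ B₁ c₁, Prop2Printed …`), (C) `∃ B₀,
   Prop6Printed …` (= §3's native ∃!), (D) the p. 299 return to (18) in print's regime `C₁B₃ε₁ ≤ ε₂` («Proposition 7 [6] implies that U_k belongs to the space
   (18) with ε₀ = O(1)C₁B₃ε₁. It is a critical configuration of the functional (5)»), (E) (141)–(142) capped at `e₅`; clause (i) = p. 296 via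
   `Prop7ChartPrint.atMostOneCriticalOrbit_of_props_inj'` + the two Sect. A laws of `Prop7AxialReprPrint`, clause (ii) = p. 299 natively with
   `O(1) = O₂·max{1, 3B₀}`, `a′₁ = min{a₄/(2B₀L³B₃), e₅/(O₂O₁L³B₃), c/(O₁L³B₃)}`.

WHY (D) CARRIES THE REGIME BINDER (located in `Prop7PV3CDENative`): `ExistenceLeavesCap.axial18` read at the T³ bridge asks `(U₁U₀)^u ∈ 𝔘_k(O₂ε₂)` for every
`ε₂` of (19); with honest letters `U₁ = 1` over a curved R2-critical background meets (19) for all `ε₂ > 0`, so only the regime `C₁B₃ε₁ ≤ ε₂` (print's use,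
ε₂ = O(1)C₁B₃ε₁) is provable, and for large `ε₂` the commutator terms of `(U₁U₀)(∂p)` are not controlled by the (19) gradients (regime `ε₂ ≤ c`, print's
«ε₁ ≤ a′₁»); the knit needs nothing more.

HONEST SCOPE.  (C), (D), (E) and P-V3-A are HYPOTHESES (typed native statements; their printed sources: Props 5–6 pp. 294–296 with (123)–(140);
[Balaban1985RegularSpaces] Prop. 7 p. 98 + [Balaban1985Variational] p. 299; (141)–(142) p. 299; [Balaban1985RegularSpaces] Thm 2 p. 83).  Prop. 5 being a
theorem here is the log-chart READING (M2′) of `Prop7TPrint` (print's analytic direction of Prop. 5 moves into (C)), not a proof of print's Sects. C–D.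
Count-neutral helper toward stmt-QuantumFields-19200 (`--supports`), not a proof of the stub.

References: T. Bałaban, CMP 102 (1985) 277–309 [Balaban1985Variational] ((14)–(21) pp.279–281, Prop. 2 p.281, Prop. 5 (104), (111)–(112) p.294, Prop. 6 (115)
p.295, (122) p.296, (123)–(142) pp.296–299, Prop. 7 p.299); CMP 99 (1985) 75–102 [Balaban1985RegularSpaces] ((1.19) p.79, (1.29) p.81, Thm 2 p.83, Prop. 7 p.98).
-/

noncomputable section

namespace Summit.QuantumFields.YangMills.Theorems.Prop7PV3CDELogChart

open Literature.MathematicalPhysics.QuantumFieldTheory.Balaban1983to89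
open Literature.MathematicalPhysics.QuantumFieldTheory.Balaban1983to89.T3ContinuumYM3Torus
open Literature.MathematicalPhysics.QuantumFieldTheory.Balaban1983to89.T3UnitLawDensityEML (ℰp)
open Literature.MathematicalPhysics.QuantumFieldTheory.Balaban1983to89.T3DescentFibreTower
open Literature.MathematicalPhysics.QuantumFieldTheory.Balaban1983to89.T3ConstrainedMinimiser
open Literature.MathematicalPhysics.QuantumFieldTheory.Balaban1983to89.T3TiltDescent
open Literature.MathematicalPhysics.QuantumFieldTheory.Balaban1983to89.T3PrintedRegularMinimiser
open Literature.MathematicalPhysics.QuantumFieldTheory.Balaban1983to89.T3PrintedRegularOrbits (descTransf gaugeAct_mem_regFibrePr_iff_of_trivial)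
open B11 (VarProblemX LGData Prop2Printed Prop5Printed Prop6Printed)
open B11Prop7Assembly (Bridge ExistenceLeavesCap one_landau_of_props silent_restrictions eps2_ge_prop2 ineq122_le second_condition_auto)
open B7Prop1Explicit renaming Site → LSite
open B7Prop2Explicit (C0 c2' C0_pos c2'_pos)
open B8Eq119TwistedAxial (InAx Restr129)
open B8Thm4TorusAt (torusLam)
open B15DeterminingSets (embIter)
open B10Eq27TorusAxialLog (pull unitsField toUField)
open B8Thm2SetupTorus (pullGauge toUGauge)
open T3Thm1Carrier
open T3Thm1CarrierNative (IsCritR2 Prop7From14At)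
open T3SectALandauChart
open Summit.QuantumFields.YangMills.Theorems.Prop7ChartInjectivity (sameOrbit_of_eq_law)
open Summit.QuantumFields.YangMills.Theorems.Prop7AxialReprPrint (inj16_print_based)
open Summit.QuantumFields.YangMills.Theorems.Prop7ChartPrint (atMostOneCriticalOrbit_of_props_inj' gaugeFix_of_conditional_axialRepr' axialRepr_print_based_uniform)
open Summit.QuantumFields.YangMills.Theorems.Prop7TPrint
open NormedSpace

open scoped Matrix.Norms.L2Operator

variable {L : ℕ}

/-! ## §1 Proposition 5 at the log-chart letters is a theorem -/

/-- A configuration with an exponent in (19) IS `e^{iX}` (`expHermField X`). [cite: Balaban1985Variational, (19) p.281, (112) p.294] -/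
theorem eq_expHermField_of_in19 {F : T3Family} {n K : ℕ} {ε₂ : ℝ} {U₀ U₁ : GaugeField (F.P K) 0 (Matrix.specialUnitaryGroup (Fin 2) ℂ)}
    {X : PBond (F.P K) 0 → Matrix (Fin 2) (Fin 2) ℂ} (h19 : In19 F n K ε₂ U₀ U₁ X) : U₁ = expHermField X := by
  funext b
  apply Subtype.ext
  rw [h19.2.1 b, expHermField_apply, coe_expHerm (h19.1 b)]

/-- The radius of a satisfiable (19) is positive. [cite: Balaban1985Variational, (19) p.281] -/
theorem pos_of_in19 {F : T3Family} {n K : ℕ} {ε₂ : ℝ} {U₀ U₁ : GaugeField (F.P K) 0 (Matrix.specialUnitaryGroup (Fin 2) ℂ)}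
    {X : PBond (F.P K) 0 → Matrix (Fin 2) (Fin 2) ℂ} (h19 : In19 F n K ε₂ U₀ U₁ X) : 0 < ε₂ := by
  have hb := h19.2.2.1 ⟨default, ⟨0, (F.P K).hd⟩⟩
  have h0 : 0 < ε₂ * eta F n K := (norm_nonneg _).trans_lt hb
  exact (mul_pos_iff_of_pos_right (eta_pos F n K)).mp h0

/-- An exponent in (19) with radius `ε₂` has size `nMax19 U₀ X < ε` for every `ε ≥ ε₂` (the four (19)-quantities are `< ε₂·ηᵃ ≤ ε·ηᵃ` on the finite
lattice). [cite: Balaban1985Variational, (19) p.281, (104) p.294] -/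
theorem nMax19_lt_of_in19 {F : T3Family} {n K : ℕ} {ε₂ ε : ℝ} {U₀ U₁ : GaugeField (F.P K) 0 (Matrix.specialUnitaryGroup (Fin 2) ℂ)}
    {X : PBond (F.P K) 0 → Matrix (Fin 2) (Fin 2) ℂ} (h19 : In19 F n K ε₂ U₀ U₁ X) (hε : ε₂ ≤ ε) : nMax19 F n K U₀ X < ε := by
  have hη : 0 < eta F n K := eta_pos F n K
  have h1 : ε₂ * eta F n K ≤ ε * eta F n K := mul_le_mul_of_nonneg_right hε hη.le
  have h2 : ε₂ * eta F n K ^ 2 ≤ ε * eta F n K ^ 2 := mul_le_mul_of_nonneg_right hε (pow_pos hη 2).le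
  have h3 : ε₂ * eta F n K ^ 3 ≤ ε * eta F n K ^ 3 := mul_le_mul_of_nonneg_right hε (pow_pos hη 3).le
  obtain ⟨-, -, hb, hg, hc, hl⟩ := h19
  exact nMax19_lt_iff.2 ⟨fun b => (hb b).trans_le h1, fun μ ν x => (hg μ ν x).trans_le h2, fun μ x => (hc μ x).trans_le h3,
    fun ν x => (hl ν x).trans_le h3⟩

/-- Conversely, a Hermitian traceless exponent of size `nMax19 U₀ X < ε` is in (19) with `ε` for the configuration `e^{iX}`.
[cite: Balaban1985Variational, (19) p.281, (112) p.294] -/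
theorem in19_expHermField_of_nMax19_lt {F : T3Family} {n K : ℕ} {ε : ℝ} {U₀ : GaugeField (F.P K) 0 (Matrix.specialUnitaryGroup (Fin 2) ℂ)}
    {X : PBond (F.P K) 0 → Matrix (Fin 2) (Fin 2) ℂ} (hX : ∀ b : PBond (F.P K) 0, (X b).IsHermitian ∧ Matrix.trace (X b) = 0)
    (hn : nMax19 F n K U₀ X < ε) : In19 F n K ε U₀ (expHermField X) X := by
  obtain ⟨hb, hg, hc, hl⟩ := nMax19_lt_iff.1 hn
  exact ⟨hX, fun b => by rw [expHermField_apply, coe_expHerm (hX b)], hb, hg, hc, hl⟩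

/-- **[Balaban1985Variational] PROPOSITION 5 HOLDS AT THE LOG-CHART LETTERS, FOR EVERY PRESENTATION OF THE SECT. A LETTERS AND ALL CONSTANTS** (reading
(M2′) of `Prop7TPrint`: «critical in (19)–(21)» ⟹ its own exponent `X = ηA` is Hermitian traceless, satisfies (20), (21), is critical — i.e. `Sol111` — has size
`< ε₂ ≤ ε₃/4 < 2ε₃` ((104)) and `e^{iX} = U₁` ((112))).  Print's direction of Prop. 5 that carries analysis (Sects. C–D) is absorbed into `Prop6Printed`'s
letters (p. 296 «by Propositions 5 and 6 there is at most one critical configuration of (5) in (19)–(21)»).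
[cite: Balaban1985Variational, Prop. 5 (104), (111)-(112) p.294, p.296] -/
theorem prop5Printed_logChart (A : ResidFam L) (B₁ B₃ C₁ : ℝ) : Prop5Printed B₁ B₃ C₁ (famLG3 L (tPrintFam A)) := by
  rw [Prop7PV3CDENative.prop5Printed_famLG3_iff]
  refine ⟨1, one_pos, fun i ε₀ ε₁ ε₂ ε₃ _ _ _ hε₂₃ _ V U₀ _ _ U₁ X h19 h20 h21 hcrit => ⟨X, ?_, ?_, ?_⟩⟩
  · have hε₂ : 0 < ε₂ := pos_of_in19 h19
    exact nMax19_lt_of_in19 h19 (by linarith)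
  · exact ⟨h19.1, h20, h21, (eq_expHermField_of_in19 h19) ▸ hcrit⟩
  · exact (eq_expHermField_of_in19 h19).symm

/-! ## §2 The leaf `crit112` at the log-chart letters is a theorem -/

/-- **THE LEAF `crit112` HOLDS AT THE LOG-CHART LETTERS** with `O₁ ≥ 3B₀` (`C₁, B₃ ≥ 0`): a `Sol111`-solution `X` of size `< 3B₀C₁B₃ε₁` has `e^{iX}` «critical in
(19)–(21)» (a conjunct of `Sol111`) and in (19) with `ε₂ = O₁C₁B₃ε₁`, (20), (21) — p. 296 *«This solution determines a critical configuration U₁ by the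
transformation (112)»* + (123)–(140), here by reading (M1′)/(M3′). [cite: Balaban1985Variational, (112) p.294, p.296 after (122), (123)-(140) pp.296-299] -/
theorem crit112_logChart (A : ResidFam L) {B₀ B₃ C₁ O₁ : ℝ} (hO₁ : 3 * B₀ ≤ O₁) (hC₁ : 0 ≤ C₁) (hB₃ : 0 ≤ B₃) (i : Idx L)
    (ε₁ : ℝ) (V : GaugeField (i.1.1.P i.1.2.1) 0 (Matrix.specialUnitaryGroup (Fin 2) ℂ))
    (U₀ : GaugeField (i.1.1.P i.1.2.2) 0 (Matrix.specialUnitaryGroup (Fin 2) ℂ)) (A₁ : PBond (i.1.1.P i.1.2.2) 0 → Matrix (Fin 2) (Fin 2) ℂ) (hε₁ : 0 < ε₁)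
    (_hreg : RegPr i.1.1 i.1.2.1 i.1.2.2 (C₁ * B₃ * ε₁) U₀) (_hclose : CloseAvg i.1.1 i.1.2.1 i.1.2.2 i.2.2.le (C₁ * ε₁) V U₀)
    (hsol : (tPrintFam A i).Sol111 V U₀ A₁) (hA₁ : (tPrintFam A i).nMax U₀ A₁ < 3 * B₀ * C₁ * B₃ * ε₁) :
    (tPrintFam A i).CritL V U₀ ((tPrintFam A i).T112 V U₀ A₁) ∧
      ∃ X : PBond (i.1.1.P i.1.2.2) 0 → Matrix (Fin 2) (Fin 2) ℂ,
        In19 i.1.1 i.1.2.1 i.1.2.2 (O₁ * C₁ * B₃ * ε₁) U₀ ((tPrintFam A i).T112 V U₀ A₁) X ∧ (tPrintFam A i).AvgCond V U₀ X ∧ (tPrintFam A i).IsLandau U₀ X := by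
  obtain ⟨hX, h20, h21, hcrit⟩ := hsol
  have hmono : 3 * B₀ * C₁ * B₃ * ε₁ ≤ O₁ * C₁ * B₃ * ε₁ := by
    have : 0 ≤ C₁ * B₃ * ε₁ := by positivity
    nlinarith
  refine ⟨hcrit, A₁, ?_, h20, h21⟩
  exact in19_expHermField_of_nMax19_lt hX (lt_of_lt_of_le hA₁ hmono)

/-! ## §3 Proposition 6 at the log-chart letters = ONE native statement: «exactly one critical configuration of (5) in (19)–(21)» near a (14)-background -/

/-- **[Balaban1985Variational] PROPOSITION 6 AT THE LOG-CHART LETTERS, NATIVE** (reading (M2′)–(M4′)): for every (14)-background (`U₀ ∈ 𝔘_k(C₁B₃ε₁)`,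
`‖Ū₀ − V‖ < C₁ε₁`), `2B₀C₁B₃ε₁ ≤ ε₄ ≤ a₄`: there is EXACTLY ONE Hermitian traceless exponent `X` of size `nMax19 U₀ X < ε₄` with (20), (21) and `e^{iX}`
«critical in (19)–(21)», and it has size `< 3B₀C₁B₃ε₁` — print p. 296 *«by Propositions 5 and 6 there is at most one critical configuration of (5) in
(19)–(21)»* together with Prop. 6's existence *«This solution satisfies the bounds (115) with ε₄ = 3B₀C₁B₃ε₁»* and (123)–(140); the 𝔄-clause and the
analyticity clause are inert at these letters. [cite: Balaban1985Variational, Prop. 6 (115) p.295, p.296, (123)-(140) pp.296-299] -/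
theorem prop6Printed_logChart_iff (A : ResidFam L) {B₀ B₃ C₁ : ℝ} :
    Prop6Printed B₀ B₃ C₁ (famLG3 L (tPrintFam A)) ↔
      ∃ a₄ : ℝ, 0 < a₄ ∧ ∀ (i : Idx L) (ε₁ ε₄ : ℝ), 0 < ε₁ → ε₄ ≤ a₄ → 2 * B₀ * C₁ * B₃ * ε₁ ≤ ε₄ →
        ∀ (V : GaugeField (i.1.1.P i.1.2.1) 0 (Matrix.specialUnitaryGroup (Fin 2) ℂ))
          (U₀ : GaugeField (i.1.1.P i.1.2.2) 0 (Matrix.specialUnitaryGroup (Fin 2) ℂ)),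
          RegPr i.1.1 i.1.2.1 i.1.2.2 (C₁ * B₃ * ε₁) U₀ → CloseAvg i.1.1 i.1.2.1 i.1.2.2 i.2.2.le (C₁ * ε₁) V U₀ →
          ∃ X : PBond (i.1.1.P i.1.2.2) 0 → Matrix (Fin 2) (Fin 2) ℂ,
            nMax19 i.1.1 i.1.2.1 i.1.2.2 U₀ X < ε₄ ∧
            ((∀ b : PBond (i.1.1.P i.1.2.2) 0, (X b).IsHermitian ∧ Matrix.trace (X b) = 0) ∧ (A i).AvgCond V U₀ X ∧ (A i).IsLandau U₀ X ∧
              (A i).CritL V U₀ (expHermField X)) ∧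
            nMax19 i.1.1 i.1.2.1 i.1.2.2 U₀ X < 3 * B₀ * C₁ * B₃ * ε₁ ∧
            ∀ X' : PBond (i.1.1.P i.1.2.2) 0 → Matrix (Fin 2) (Fin 2) ℂ, nMax19 i.1.1 i.1.2.1 i.1.2.2 U₀ X' < ε₄ →
              ((∀ b : PBond (i.1.1.P i.1.2.2) 0, (X' b).IsHermitian ∧ Matrix.trace (X' b) = 0) ∧ (A i).AvgCond V U₀ X' ∧ (A i).IsLandau U₀ X' ∧
                (A i).CritL V U₀ (expHermField X')) → X' = X := by
  rw [Prop7PV3CDENative.prop6Printed_famLG3_iff]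
  constructor
  · rintro ⟨a₄, ha₄, H⟩
    refine ⟨a₄, ha₄, fun i ε₁ ε₄ hε₁ hε₄ h2B V U₀ hreg hclose => ?_⟩
    obtain ⟨⟨X, hX, hsol, hX3, huniq⟩, -, -⟩ := H i ε₁ ε₄ hε₁ hε₄ h2B V U₀ hreg hclose
    exact ⟨X, hX, hsol, hX3, huniq⟩
  · rintro ⟨a₄, ha₄, H⟩
    refine ⟨a₄, ha₄, fun i ε₁ ε₄ hε₁ hε₄ h2B V U₀ hreg hclose => ⟨?_, fun 𝔄 h𝔄 => h𝔄.elim, trivial⟩⟩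
    obtain ⟨X, hX, hsol, hX3, huniq⟩ := H i ε₁ ε₄ hε₁ hε₄ h2B V U₀ hreg hclose
    exact ⟨X, hX, hsol, hX3, huniq⟩

/-! ## §4 THE KNIT AT THE LOG-CHART LETTERS: V3 ⇐ P-V3-A ∧ «exactly one Landau-critical configuration» ∧ [B8]-Prop-7 return to (18) ∧ (142) -/

/-- **THE 19200 LEAF V3 `Prop7From14At L B₃` AT THE v8 PRESENTATION `tPrintFam A` FROM FOUR NATIVE T³ STATEMENTS** — for every presentation `A` of the Sect. A letters with
print's based (1.19)/(1.29) readings (`hSax`, `hSre`, as in `Prop7PillarsPrint.prop7From14At_of_pillars_print`): (A) P-V3-A `∃ B₁ c₁, Prop2Printed B₁ B₃ L³ c₁`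
([Balaban1985RegularSpaces] Thm 2); (C) «exactly one configuration critical in (19)–(21) near every (14)-background» (= `Prop6Printed` at these letters,
`prop6Printed_logChart_iff`; print Props 5–6 p. 296 + (123)–(140)); (D) the p. 299 return to (18) IN PRINT'S REGIME `C₁B₃ε₁ ≤ ε₂ ≤ c`: a configuration `U₁` in
(19)–(21) at `ε₂` over a (14)-background which is «critical in (19)–(21)» has a (1.29)-restricted `u` with `(U₁U₀)^u ∈ 𝔘_k(O₂ε₂) ∩ 𝔅_k(V)` critical in reading R2
([Balaban1985RegularSpaces] Prop. 7 + p. 299; the plaquette clause of the estimate is `Prop7B8Prop7Plaq.plaqSmall_gaugeAct_emb15_of_in19`); (E) (141)–(142): for `e ≤ e₅` such a `(U₁U₀)^u ∈ (6)(e)` minimises over `(6)(e)`.  Prop. 5 and the leaf `crit112`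
are THEOREMS here (§1–§2); the assembly is print's p. 296 ((122), clause (i), via `Prop7ChartPrint.atMostOneCriticalOrbit_of_props_inj'` with the two Sect. A laws of
`Prop7AxialReprPrint`) and p. 299 (clause (ii), with `O(1) = O₂·max{1, 3B₀}` and `a′₁ = min{a₄/(2B₀L³B₃), e₅/(O₂O₁L³B₃), c/(O₁L³B₃)}`).
[cite: Balaban1985Variational, Prop. 7 p.299, Prop. 2 p.281, Props 5-6 pp.294-295, (122) p.296, (141)-(142) p.299; Balaban1985RegularSpaces, Thm 2 p.83, Prop. 7 p.98] -/
theorem prop7From14At_of_natives_logChart (hL : 1 < L) (A : ResidFam L) {B₃ : ℝ} (hB₃ : 1 ≤ B₃)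
    (hSax : ∀ (i : Idx L) (U₀ U : GaugeField (i.1.1.P i.1.2.2) 0 (Matrix.specialUnitaryGroup (Fin 2) ℂ)),
      (A i).IsAxial U₀ U ↔
        InAx (i.1.1.P i.1.2.2).L (i.1.2.2 - i.1.2.1) (torusLam (i.1.2.2 - i.1.2.1))
          (pull (unitsField (toUField U₀)) (embIter (i.1.2.2 - i.1.2.1) (0 : Site (i.1.1.P i.1.2.2) (i.1.2.2 - i.1.2.1))))
          (pull (unitsField (toUField U)) (embIter (i.1.2.2 - i.1.2.1) (0 : Site (i.1.1.P i.1.2.2) (i.1.2.2 - i.1.2.1)))))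
    (hSre : ∀ (i : Idx L) (U₀ : GaugeField (i.1.1.P i.1.2.2) 0 (Matrix.specialUnitaryGroup (Fin 2) ℂ))
      (u : GaugeTransf (i.1.1.P i.1.2.2) 0 (Matrix.specialUnitaryGroup (Fin 2) ℂ)), (A i).Restricted U₀ u →
        Restr129 (i.1.1.P i.1.2.2).L (i.1.2.2 - i.1.2.1) (torusLam (i.1.2.2 - i.1.2.1))
          (pull (unitsField (toUField U₀)) (embIter (i.1.2.2 - i.1.2.1) (0 : Site (i.1.1.P i.1.2.2) (i.1.2.2 - i.1.2.1))))
          (pullGauge (fun x => Unitary.toUnits (toUGauge (i.1.1.P i.1.2.2) 2 u x)) (embIter (i.1.2.2 - i.1.2.1) (0 : Site (i.1.1.P i.1.2.2) (i.1.2.2 - i.1.2.1)))))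
    (hA : ∃ B₁ c₁ : ℝ, 0 < B₁ ∧ 0 < c₁ ∧ Prop2Printed B₁ B₃ ((L : ℝ) ^ 3) c₁ (famLG3 L (tPrintFam A)))
    (hC : ∃ B₀ : ℝ, 0 < B₀ ∧ Prop6Printed B₀ B₃ ((L : ℝ) ^ 3) (famLG3 L (tPrintFam A)))
    (hD : ∃ O₂ c : ℝ, 1 ≤ O₂ ∧ 0 < c ∧ ∀ (i : Idx L) (ε₁ ε₂ : ℝ) (V : GaugeField (i.1.1.P i.1.2.1) 0 (Matrix.specialUnitaryGroup (Fin 2) ℂ))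
      (U₀ U₁ : GaugeField (i.1.1.P i.1.2.2) 0 (Matrix.specialUnitaryGroup (Fin 2) ℂ)) (X : PBond (i.1.1.P i.1.2.2) 0 → Matrix (Fin 2) (Fin 2) ℂ),
      (L : ℝ) ^ 3 * B₃ * ε₁ ≤ ε₂ → ε₂ ≤ c → RegPr i.1.1 i.1.2.1 i.1.2.2 ((L : ℝ) ^ 3 * B₃ * ε₁) U₀ → CloseAvg i.1.1 i.1.2.1 i.1.2.2 i.2.2.le ((L : ℝ) ^ 3 * ε₁) V U₀ →
      In19 i.1.1 i.1.2.1 i.1.2.2 ε₂ U₀ U₁ X → (A i).AvgCond V U₀ X → (A i).IsLandau U₀ X → (A i).CritL V U₀ U₁ →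
        ∃ u : GaugeTransf (i.1.1.P i.1.2.2) 0 (Matrix.specialUnitaryGroup (Fin 2) ℂ), (A i).Restricted U₀ u ∧
          RegPr i.1.1 i.1.2.1 i.1.2.2 (O₂ * ε₂) (GaugeField.gaugeAct u (emb15 U₀ U₁)) ∧
          GaugeField.gaugeAct u (emb15 U₀ U₁) ∈ fibre i.1.1 ℰp i.1.2.1 i.1.2.2 i.2.2.le V ∧
          IsCritR2 i.1.1 i.1.2.1 i.1.2.2 i.2.2.le V (GaugeField.gaugeAct u (emb15 U₀ U₁)))
    (hE : ∃ e₅ : ℝ, 0 < e₅ ∧ ∀ (i : Idx L) (e ε₁ : ℝ) (V : GaugeField (i.1.1.P i.1.2.1) 0 (Matrix.specialUnitaryGroup (Fin 2) ℂ))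
      (U₀ U₁ : GaugeField (i.1.1.P i.1.2.2) 0 (Matrix.specialUnitaryGroup (Fin 2) ℂ)) (u : GaugeTransf (i.1.1.P i.1.2.2) 0 (Matrix.specialUnitaryGroup (Fin 2) ℂ)),
      e ≤ e₅ → RegPr i.1.1 i.1.2.1 i.1.2.2 ((L : ℝ) ^ 3 * B₃ * ε₁) U₀ → CloseAvg i.1.1 i.1.2.1 i.1.2.2 i.2.2.le ((L : ℝ) ^ 3 * ε₁) V U₀ →
      (A i).CritL V U₀ U₁ → (A i).Restricted U₀ u → RegPr i.1.1 i.1.2.1 i.1.2.2 e (GaugeField.gaugeAct u (emb15 U₀ U₁)) →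
      GaugeField.gaugeAct u (emb15 U₀ U₁) ∈ fibre i.1.1 ℰp i.1.2.1 i.1.2.2 i.2.2.le V →
      IsCritR2 i.1.1 i.1.2.1 i.1.2.2 i.2.2.le V (GaugeField.gaugeAct u (emb15 U₀ U₁)) →
        GaugeField.gaugeAct u (emb15 U₀ U₁) ∈ regFibrePr i.1.1 i.1.2.1 i.1.2.2 i.2.2.le e V ∧
        IsMinOn (fun W : GaugeField (i.1.1.P i.1.2.2) 0 (Matrix.specialUnitaryGroup (Fin 2) ℂ) => wilsonAction4 W)
          (regFibrePr i.1.1 i.1.2.1 i.1.2.2 i.2.2.le e V) (GaugeField.gaugeAct u (emb15 U₀ U₁))) :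
    Prop7From14At L B₃ := by
  have hL1 : (1 : ℝ) ≤ (L : ℝ) := by exact_mod_cast hL.le
  have hC₁ : (1 : ℝ) ≤ (L : ℝ) ^ 3 := one_le_pow₀ hL1
  have hC₁pos : (0 : ℝ) < (L : ℝ) ^ 3 := by positivity
  have hC0 : 0 < C0 3 := C0_pos _
  have hc2 : 0 < c2' 3 L := c2'_pos _ _ hL.le
  have he : 0 < min (1 / (6 * C0 3 * (L : ℝ) ^ 3)) (c2' 3 L / (4 * (L : ℝ) ^ 3)) := lt_min (by positivity) (by positivity)
  obtain ⟨B₁, c₁, hB₁, hc₁, h2⟩ := hA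
  obtain ⟨B₀, hB₀, h6⟩ := hC
  obtain ⟨O₂, c, hO₂, hc, HD⟩ := hD
  obtain ⟨e₅, he₅, HE⟩ := hE
  -- Thm 2's constant reconciled as in `Prop7PillarsPrint`: B₁* := max{B₁, B₀/4}
  set Bs : ℝ := max B₁ (B₀ / 4) with hBs
  have h1 : B₁ ≤ Bs := le_max_left _ _
  have h0 : B₀ / 4 ≤ Bs := le_max_right _ _
  have hBs0 : 0 < Bs := lt_of_lt_of_le hB₁ h1
  have hB₀Bs : B₀ ≤ 4 * Bs := by linarith
  have h2' : Prop2Printed Bs B₃ ((L : ℝ) ^ 3) c₁ (famLG3 L (tPrintFam A)) := Prop7PillarsPrint.prop2Printed_mono h1 hC₁pos.le h2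
  have h5 : Prop5Printed Bs B₃ ((L : ℝ) ^ 3) (famLG3 L (tPrintFam A)) := prop5Printed_logChart A Bs B₃ _
  -- the Sect. A letters of `tPrintFam A` are `A`'s
  have hSax' : ∀ (i : Idx L) (U₀ U : GaugeField (i.1.1.P i.1.2.2) 0 (Matrix.specialUnitaryGroup (Fin 2) ℂ)), (tPrintFam A i).IsAxial U₀ U ↔
      InAx (i.1.1.P i.1.2.2).L (i.1.2.2 - i.1.2.1) (torusLam (i.1.2.2 - i.1.2.1))
        (pull (unitsField (toUField U₀)) (embIter (i.1.2.2 - i.1.2.1) (0 : Site (i.1.1.P i.1.2.2) (i.1.2.2 - i.1.2.1))))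
        (pull (unitsField (toUField U)) (embIter (i.1.2.2 - i.1.2.1) (0 : Site (i.1.1.P i.1.2.2) (i.1.2.2 - i.1.2.1)))) := hSax
  have hSre' : ∀ (i : Idx L) (U₀ : GaugeField (i.1.1.P i.1.2.2) 0 (Matrix.specialUnitaryGroup (Fin 2) ℂ))
      (u : GaugeTransf (i.1.1.P i.1.2.2) 0 (Matrix.specialUnitaryGroup (Fin 2) ℂ)), (tPrintFam A i).Restricted U₀ u →
        Restr129 (i.1.1.P i.1.2.2).L (i.1.2.2 - i.1.2.1) (torusLam (i.1.2.2 - i.1.2.1))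
          (pull (unitsField (toUField U₀)) (embIter (i.1.2.2 - i.1.2.1) (0 : Site (i.1.1.P i.1.2.2) (i.1.2.2 - i.1.2.1))))
          (pullGauge (fun x => Unitary.toUnits (toUGauge (i.1.1.P i.1.2.2) 2 u x)) (embIter (i.1.2.2 - i.1.2.1) (0 : Site (i.1.1.P i.1.2.2) (i.1.2.2 - i.1.2.1)))) :=
    hSre
  -- CLAUSE (i), p. 296: Props 2, 5, 6 + the two Sect. A laws of `Prop7AxialReprPrint`
  obtain ⟨a₀, ha₀, HU⟩ := atMostOneCriticalOrbit_of_props_inj' (bridgeFam3 L (tPrintFam A)) he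
    (fun i ε₀ ε₁ V U₀ U hεe hB₃ε h14 hU hB =>
      gaugeFix_of_conditional_axialRepr' i.1.1 i.2.2.le (tPrintFam A i)
        (fun ε₀ ε₁ V U₀ U hεe hB₃ε h14 hU => by
          obtain ⟨v, hv, hvAx⟩ := axialRepr_print_based_uniform i.1.1 i.2.1 i.2.2.le hC₁ B₃ ε₀ ε₁ V U₀ U hεe hB₃ε h14 hU
          exact ⟨v, hv, (hSax' i U₀ _).2 (hvAx _)⟩)
        ε₀ ε₁ V U₀ U hεe hB₃ε h14 hU hB)
    (fun i ε₀ V U₀ U₁ u u' hu hu' h18 h18' => by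
      show T3Thm1Carrier.SameOrbit i.1.1 i.1.2.1 i.1.2.2 i.2.2.le (emb15 U₀ (act16 U₀ u U₁)) (emb15 U₀ (act16 U₀ u' U₁))
      have h18a : emb15 U₀ (act16 U₀ u U₁) ∈ regFibrePr i.1.1 i.1.2.1 i.1.2.2 i.2.2.le ε₀ V ∧
          (tPrintFam A i).IsAxial U₀ (emb15 U₀ (act16 U₀ u U₁)) := h18
      have h18b : emb15 U₀ (act16 U₀ u' U₁) ∈ regFibrePr i.1.1 i.1.2.1 i.1.2.2 i.2.2.le ε₀ V ∧
          (tPrintFam A i).IsAxial U₀ (emb15 U₀ (act16 U₀ u' U₁)) := h18'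
      rw [emb15_act16] at h18a h18b
      rw [emb15_act16, emb15_act16]
      exact sameOrbit_of_eq_law i.1.1 i.2.2.le (tPrintFam A i)
        (inj16_print_based i.1.1 i.2.2.le (tPrintFam A i) (fun U₀ U hU => (hSax' i U₀ U).1 hU) (hSre' i)) ε₀ V U₀ U₁ u u' hu hu' h18a h18b)
    (fun i _ _ hUU' => sameOrbit_symm i.1.1 i.2.2.le hUU') (fun i _ _ _ h₁ h₂ => sameOrbit_trans i.1.1 i.2.2.le h₁ h₂)
    hBs0 hB₃ hC₁ hB₀Bs hc₁ h2' h5 h6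
  -- CLAUSE (ii), p. 299, natively: Prop. 6's solution ↦ (112) ↦ (19)–(21) with O₁C₁B₃ε₁ ↦ axial gauge, (18) with O₂O₁C₁B₃ε₁ ↦ (142)
  obtain ⟨a₄, ha₄, H6⟩ := (prop6Printed_logChart_iff A).1 h6
  set O₁ : ℝ := max 1 (3 * B₀) with hO₁
  have hO₁1 : 1 ≤ O₁ := le_max_left _ _
  have hO₁3 : 3 * B₀ ≤ O₁ := le_max_right _ _
  have hO₁0 : 0 < O₁ := lt_of_lt_of_le one_pos hO₁1
  have hK : 0 < 2 * B₀ * (L : ℝ) ^ 3 * B₃ := by positivity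
  have hK' : 0 < O₂ * O₁ * (L : ℝ) ^ 3 * B₃ := by positivity
  have hK'' : 0 < O₁ * (L : ℝ) ^ 3 * B₃ := by positivity
  set a₁' : ℝ := min (min (a₄ / (2 * B₀ * (L : ℝ) ^ 3 * B₃)) (e₅ / (O₂ * O₁ * (L : ℝ) ^ 3 * B₃))) (c / (O₁ * (L : ℝ) ^ 3 * B₃)) with ha₁'
  have ha₁'0 : 0 < a₁' := lt_min (lt_min (div_pos ha₄ hK) (div_pos he₅ hK')) (div_pos hc hK'')
  refine ⟨a₀, a₁', O₂ * O₁, ha₀, ha₁'0, one_le_mul_of_one_le_of_one_le hO₂ hO₁1, ?_⟩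
  intro i ε₀ ε₁ hε₁ V _hV U₀ hU₀ hB
  have h14 : (famLG3 L (tPrintFam A) i).Sat14 ((L : ℝ) ^ 3 * B₃ * ε₁) ((L : ℝ) ^ 3 * ε₁) ((bridgeFam3 L (tPrintFam A) i).bdry V) U₀ := by
    obtain ⟨⟨F, n, K⟩, hF, hnK⟩ := i
    exact sat14T3_of_mem_fibre (mul_pos hC₁pos hε₁) hU₀ hB
  refine ⟨fun hε₀a hB₃ε => HU i ε₀ ε₁ hε₁ hε₀a hB₃ε V U₀ h14, fun hε₁a => ?_⟩
  obtain ⟨⟨F, n, K⟩, hF, hnK⟩ := i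
  obtain ⟨hreg, hclose⟩ := h14
  -- Prop. 6 at ε₄ = a₄
  have h2B : 2 * B₀ * (L : ℝ) ^ 3 * B₃ * ε₁ ≤ a₄ := by
    have := (le_div_iff₀ hK).1 (hε₁a.trans ((min_le_left _ _).trans (min_le_left _ _))); linarith
  have hcap : O₂ * (O₁ * (L : ℝ) ^ 3 * B₃ * ε₁) ≤ e₅ := by
    have := (le_div_iff₀ hK').1 (hε₁a.trans ((min_le_left _ _).trans (min_le_right _ _))); linarith
  have hεc : O₁ * (L : ℝ) ^ 3 * B₃ * ε₁ ≤ c := by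
    have := (le_div_iff₀ hK'').1 (hε₁a.trans (min_le_right _ _)); linarith
  obtain ⟨X, -, ⟨hX, h20, h21, hcrit⟩, hX3, -⟩ := H6 ⟨(F, n, K), hF, hnK⟩ ε₁ a₄ hε₁ le_rfl h2B V U₀ hreg hclose
  -- (112): `e^{iX}` is in (19) with O₁C₁B₃ε₁
  have h19 : In19 F n K (O₁ * (L : ℝ) ^ 3 * B₃ * ε₁) U₀ (expHermField X) X := by
    have hmono : 3 * B₀ * (L : ℝ) ^ 3 * B₃ * ε₁ ≤ O₁ * (L : ℝ) ^ 3 * B₃ * ε₁ := by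
      have : 0 ≤ (L : ℝ) ^ 3 * B₃ * ε₁ := by positivity
      nlinarith
    exact in19_expHermField_of_nMax19_lt hX (lt_of_lt_of_le hX3 hmono)
  -- p. 299: the axial gauge, (18) with O₂·O₁C₁B₃ε₁ (print's regime C₁B₃ε₁ ≤ ε₂ holds since O₁ ≥ 1)
  have hreg₂ : (L : ℝ) ^ 3 * B₃ * ε₁ ≤ O₁ * (L : ℝ) ^ 3 * B₃ * ε₁ := by
    have : 0 ≤ (L : ℝ) ^ 3 * B₃ * ε₁ := by positivity
    nlinarith
  obtain ⟨u, hu, hRegW, hWfib, hWcrit⟩ :=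
    HD ⟨(F, n, K), hF, hnK⟩ ε₁ (O₁ * (L : ℝ) ^ 3 * B₃ * ε₁) V U₀ (expHermField X) X hreg₂ hεc hreg hclose h19 h20 h21 hcrit
  -- (142): minimal over (6)(O₂O₁C₁B₃ε₁)
  have hO : O₂ * O₁ * (L : ℝ) ^ 3 * B₃ * ε₁ = O₂ * (O₁ * (L : ℝ) ^ 3 * B₃ * ε₁) := by ring
  obtain ⟨hWmem, hWmin⟩ := HE ⟨(F, n, K), hF, hnK⟩ (O₂ * (O₁ * (L : ℝ) ^ 3 * B₃ * ε₁)) ε₁ V U₀ (expHermField X) u hcap hreg hclose hcrit hu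
    hRegW hWfib hWcrit
  refine ⟨GaugeField.gaugeAct u (emb15 U₀ (expHermField X)), ?_⟩
  show GaugeField.gaugeAct u (emb15 U₀ (expHermField X)) ∈ regFibrePr F n K hnK.le (O₂ * O₁ * (L : ℝ) ^ 3 * B₃ * ε₁) V ∧
    IsMinOn (fun W : GaugeField (F.P K) 0 (Matrix.specialUnitaryGroup (Fin 2) ℂ) => wilsonAction4 W)
      (regFibrePr F n K hnK.le (O₂ * O₁ * (L : ℝ) ^ 3 * B₃ * ε₁) V) (GaugeField.gaugeAct u (emb15 U₀ (expHermField X)))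
  rw [hO]
  exact ⟨hWmem, hWmin⟩

end Summit.QuantumFields.YangMills.Theorems.Prop7PV3CDELogChart

end
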